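import Summits.HubbardSuperconductivity.HubbardSuperconductivity.Theorems.BalabanIRBirEveryGroundStateAffine
import HarnessLib

/-!
# Crux `JmPairBridge` (stmt-HubbardSuperconductivity-2226), line `Sketch`:
# stub `stub_spectralConcentration`

Route `JosephsonMirror`, crux `JmPairBridge` (the every-ground-state pair bridge between adjacent
charge-sector ground floors of the Hubbard torus). This file is the ABSTRACT linear-algebra step of
the lead skeleton (line `Sketch`, card `pair-sum-rule-concentration`): spectral concentration, alias
Eckart–Markov capture, on an invariant sector.

Statement. `H` a Hermitian matrix, `K ≠ ⊥` a subspace with `H K ⊆ K`, `E = minEnergyOn H K` the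
bottom of the Rayleigh quotient on `K`, `G = {χ ∈ K | H χ = E χ}` the ground floor of `H|K`, and
`γ > 0` a gap on the orthocomplement of `G` in `K`: `(E + γ) ‖w‖² ≤ Re⟨w, H w⟩` for every `w ∈ K`
orthogonal to `G`. Then every `v ∈ K` has a UNIT ground vector `χ ∈ G` with
`γ (‖v‖² − |⟨χ, v⟩|²) ≤ Re⟨v, H v⟩ − E ‖v‖²`.

Proof. Split `v = g + r` with `g = P_G v` the orthogonal projection onto `G` (tree `projMatrix`)
and `r = v − g ∈ K ∩ G^⊥`. Hermiticity and `H g = E g` kill the cross terms, so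
`Re⟨v, H v⟩ = E ‖g‖² + Re⟨r, H r⟩ ≥ E ‖g‖² + (E + γ) ‖r‖² = E ‖v‖² + γ (‖v‖² − ‖g‖²)` (Pythagoras).
If `g ≠ 0` take `χ = g/‖g‖`, for which `|⟨χ, v⟩|² = ‖g‖²`; if `g = 0` take any unit ground vector
(the Rayleigh quotient attains its infimum on the compact unit sphere of `K`, and a minimiser on an
invariant sector is an eigenvector) and use `|⟨χ, v⟩|² ≥ 0`.

Sources: H. Tasaki, *Physics and Mathematics of Quantum Many-Body Systems* (2020) §2.1 (variational
principle, ground floor); C. Eckart, Phys. Rev. 36 (1930) 878 (capture of a trial vector by the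
ground floor under a gap); folklore finite-dimensional linear algebra. No definition, no named fact.
-/

noncomputable section

-- the mandated namespace `Summit.<Summit>.<Problem>.Theorems` repeats `HubbardSuperconductivity`
-- (single-problem summit, D-0017), which the `dupNamespace` linter flags on every declaration
set_option linter.dupNamespace false

namespace Summit.HubbardSuperconductivity.HubbardSuperconductivity.Theorems.JosephsonMirror

open Matrix Literature.MathematicalPhysics.QuantumLattice
open Literature.MathematicalPhysics.QuantumLattice.EigenvalueContinuation
open scoped ComplexOrder

/-- A sector `K ≠ ⊥` carries a UNIT ground vector of `H|K`: the Rayleigh quotient attains its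
infimum `minEnergyOn H K` on the compact unit sphere of `K`, and on an `H`-invariant sector a
minimiser is an eigenvector (`mulVec_eq_smul_of_forall_le_on`). Tasaki (2020) §2.1. [folklore] -/
theorem sc_exists_unit_groundVector {n : Type*} [Fintype n] {H : Matrix n n ℂ} (hH : H.IsHermitian)
    (K : Submodule ℂ (n → ℂ)) (hK : ∀ w ∈ K, H *ᵥ w ∈ K) (hKne : K ≠ ⊥) :
    ∃ ψ ∈ K, star ψ ⬝ᵥ ψ = 1 ∧ H *ᵥ ψ = ((H.minEnergyOn K : ℝ) : ℂ) • ψ := by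
  obtain ⟨v, hvK, hv⟩ := K.ne_bot_iff.1 hKne
  obtain ⟨c, -, -, h1⟩ := exists_normalize hv
  have hne : {w : n → ℂ | w ∈ K ∧ star w ⬝ᵥ w = 1}.Nonempty :=
    ⟨(c : ℂ) • v, K.smul_mem _ hvK, h1⟩
  obtain ⟨w, hw, hmin⟩ :=
    (isCompact_unitSphere_inter K).exists_isMinOn hne (continuous_energy H).continuousOn
  have hEq : (star w ⬝ᵥ H *ᵥ w).re = H.minEnergyOn K := by
    symm
    refine IsLeast.csInf_eq ⟨⟨w, hw.1, hw.2, rfl⟩, ?_⟩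
    rintro E ⟨ψ, hψK, hψ1, rfl⟩
    exact (isMinOn_iff.mp hmin) ψ ⟨hψK, hψ1⟩
  refine ⟨w, hw.1, hw.2, ?_⟩
  exact mulVec_eq_smul_of_forall_le_on hH.eq K hK (fun u hu => minEnergyOn_mul_re_le H K hu) hw.1
    (by rw [hw.2, Complex.one_re, mul_one, hEq])

/-- **Spectral concentration / Eckart–Markov capture on an invariant sector.** `H` Hermitian
preserving a sector `K ≠ ⊥`; if every vector of `K` orthogonal to the ground floor of `H|K` (the
eigenvectors in `K` with eigenvalue `minEnergyOn H K`) pays `≥ (minEnergyOn H K + γ)‖w‖²`, `γ > 0`,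
then every `v ∈ K` has a unit ground vector `χ ∈ K` of `H|K` with
`γ (‖v‖² − |⟨χ, v⟩|²) ≤ Re⟨v, Hv⟩ − minEnergyOn H K · ‖v‖²` (`χ = P_floor v/‖P_floor v‖`, or any
unit floor vector if `P_floor v = 0`). Tasaki (2020) §2.1; Eckart, Phys. Rev. 36 (1930) 878.
[folklore] -/
theorem stub_spectralConcentration {n : Type*} [Fintype n] [DecidableEq n]
    (H : Matrix n n ℂ) (K : Submodule ℂ (n → ℂ)) (γ : ℝ) (v : n → ℂ)
    (hH : H.IsHermitian) (hK : ∀ w ∈ K, H *ᵥ w ∈ K) (hKne : K ≠ ⊥) (hγ : 0 < γ)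
    (hgap : ∀ w ∈ K, (∀ χ ∈ K, H *ᵥ χ = ((H.minEnergyOn K : ℝ) : ℂ) • χ → star χ ⬝ᵥ w = 0) →
      (H.minEnergyOn K + γ) * (star w ⬝ᵥ w).re ≤ (star w ⬝ᵥ H *ᵥ w).re)
    (hv : v ∈ K) :
    ∃ χ ∈ K, star χ ⬝ᵥ χ = 1 ∧ H *ᵥ χ = ((H.minEnergyOn K : ℝ) : ℂ) • χ ∧
      γ * ((star v ⬝ᵥ v).re - ‖star χ ⬝ᵥ v‖ ^ 2) ≤
        (star v ⬝ᵥ H *ᵥ v).re - H.minEnergyOn K * (star v ⬝ᵥ v).re := by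
  -- the ground floor `G = K ⊓ ker (H - E)` and the orthogonal projection `P` onto it
  set E : ℝ := H.minEnergyOn K with hE
  set G : Submodule ℂ (n → ℂ) := K ⊓ Module.End.eigenspace (Matrix.toLin' H) (E : ℂ) with hG
  have hmemG : ∀ χ, χ ∈ G ↔ χ ∈ K ∧ H *ᵥ χ = (E : ℂ) • χ := fun χ => by
    rw [hG, Submodule.mem_inf, Module.End.mem_eigenspace_iff, Matrix.toLin'_apply]
  set P : Matrix n n ℂ := projMatrix (G.map ((WithLp.linearEquiv 2 ℂ (n → ℂ)).symm :
      (n → ℂ) →ₗ[ℂ] EuclideanSpace ℂ n)) with hP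
  -- the split `v = g + r`, `g ∈ G`, `r ∈ K ∩ G^⊥`
  set g : n → ℂ := P *ᵥ v with hg
  set r : n → ℂ := v - g with hr
  have hgG : g ∈ G := projMatrix_map_mulVec_mem G v
  obtain ⟨hgK, hHg⟩ := (hmemG g).1 hgG
  have hrK : r ∈ K := K.sub_mem hv hgK
  have horth : ∀ χ ∈ G, star χ ⬝ᵥ r = 0 := fun χ hχ =>
    star_dotProduct_sub_projMatrix_map_mulVec G hχ v
  have hgap_r : (E + γ) * (star r ⬝ᵥ r).re ≤ (star r ⬝ᵥ H *ᵥ r).re :=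
    hgap r hrK fun χ hχK hχE => horth χ ((hmemG χ).2 ⟨hχK, hχE⟩)
  have hgr : star g ⬝ᵥ r = 0 := horth g hgG
  have hrg : star r ⬝ᵥ g = 0 := by rw [star_dotProduct, hgr, star_zero]
  have hvgr : v = g + r := by rw [hr, add_sub_cancel]
  -- Pythagoras and the energy split (cross terms vanish by hermiticity and `H g = E g`)
  have hnorm : (star v ⬝ᵥ v).re = (star g ⬝ᵥ g).re + (star r ⬝ᵥ r).re := by
    rw [hvgr, star_add, add_dotProduct, dotProduct_add, dotProduct_add, hgr, hrg, add_zero,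
      zero_add, Complex.add_re]
  have henergy : (star v ⬝ᵥ H *ᵥ v).re = E * (star g ⬝ᵥ g).re + (star r ⬝ᵥ H *ᵥ r).re := by
    have h1 : star r ⬝ᵥ H *ᵥ g = 0 := by rw [hHg, dotProduct_smul, hrg, smul_zero]
    have h2 : star g ⬝ᵥ H *ᵥ r = 0 := by rw [star_dotProduct_mulVec_comm hH.eq, h1, star_zero]
    rw [hvgr, mulVec_add, star_add, add_dotProduct, dotProduct_add, dotProduct_add, h1, h2,
      add_zero, zero_add, Complex.add_re, re_star_dotProduct_mulVec_of_eigen hHg]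
  have hmain : γ * ((star v ⬝ᵥ v).re - (star g ⬝ᵥ g).re) ≤
      (star v ⬝ᵥ H *ᵥ v).re - E * (star v ⬝ᵥ v).re := by
    rw [hnorm, henergy]
    linarith [hgap_r]
  -- it remains to find a unit ground vector capturing at least `‖g‖²` of `v`
  suffices hχ : ∃ χ ∈ K, star χ ⬝ᵥ χ = 1 ∧ H *ᵥ χ = (E : ℂ) • χ ∧
      (star g ⬝ᵥ g).re ≤ ‖star χ ⬝ᵥ v‖ ^ 2 by
    obtain ⟨χ, hχK, hχ1, hχE, hχg⟩ := hχ
    refine ⟨χ, hχK, hχ1, hχE, ?_⟩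
    calc γ * ((star v ⬝ᵥ v).re - ‖star χ ⬝ᵥ v‖ ^ 2)
        ≤ γ * ((star v ⬝ᵥ v).re - (star g ⬝ᵥ g).re) :=
          mul_le_mul_of_nonneg_left (by linarith) hγ.le
      _ ≤ (star v ⬝ᵥ H *ᵥ v).re - E * (star v ⬝ᵥ v).re := hmain
  by_cases hg0 : g = 0
  · -- `P_G v = 0`: any unit ground vector will do
    obtain ⟨ψ, hψK, hψ1, hψE⟩ := sc_exists_unit_groundVector hH K hK hKne
    refine ⟨ψ, hψK, hψ1, hψE, ?_⟩
    rw [hg0, dotProduct_zero, Complex.zero_re]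
    positivity
  · -- `χ = g/‖g‖`: `⟨χ, v⟩ = ‖g‖`
    obtain ⟨c, -, hcc, h1⟩ := exists_normalize hg0
    refine ⟨(c : ℂ) • g, K.smul_mem _ hgK, h1, ?_, ?_⟩
    · rw [mulVec_smul, hHg]
      exact smul_comm _ _ _
    · set q : ℝ := (star g ⬝ᵥ g).re with hq
      have hgg : star g ⬝ᵥ g = (q : ℂ) :=
        Complex.ext (by simp [hq]) (by simp [im_star_dotProduct_self])
      have hgv : star g ⬝ᵥ v = (q : ℂ) := by rw [hvgr, dotProduct_add, hgr, add_zero, hgg]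
      have hχv : star ((c : ℂ) • g) ⬝ᵥ v = ((c * q : ℝ) : ℂ) := by
        rw [star_smul, smul_dotProduct, hgv, Complex.star_def, Complex.conj_ofReal, smul_eq_mul,
          Complex.ofReal_mul]
      rw [hχv, Complex.norm_real, Real.norm_eq_abs, sq_abs]
      have hsq : (c * q) ^ 2 = q := by
        calc (c * q) ^ 2 = c * c * q * q := by ring
          _ = q := by rw [hcc, one_mul]
      rw [hsq]
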